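import Mathlib
import HarnessLib
import HarnessLib.Audit
import Summits.Ventures.CertifiedManyBodySolver.HubbardAlg.MbsolverRungLeaves
import Summits.Ventures.CertifiedManyBodySolver.Rows.DopedTLCorr
import Summits.Ventures.CertifiedManyBodySolver.Observables.PairBoxWordD4
import Summits.Ventures.CertifiedManyBodySolver.Observables.RungLeavesSummit
import Summits.Ventures.CertifiedManyBodySolver.Certificates.HubbardSquare_n7o8_obs0blite_T2direct_tp0_F2rows_j242269

/-!
Route: M3ObsPairLroHalfViaF2

DORMANT since 2026-08-31T08:46:17Z (director-hubbard g25 08:45:16Z (3): F2-PRIMAL letter (C) by record 08-31: EXT5-L⁺ degree-4 optimum −76.04 at u₃₅₄ (j242461 converged pair), first-order transport −75.3 at u_RS (κ 115.07); threshold −4) — unstaffed, not closed; items shared with open routes are served there. `ledger route dormant <id> --off` reactivates.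

# Route M3ObsPairLroHalfViaF2 — M3′-obs pair-LRO ceiling 1/2 at (8, 7/8, 0) as a declared split — a
certified F₂ box orbit row ≥ −81/2 at the cap of record and the cap leaf M3Upper_tp0_le_RS decide
the summit-format leaf

It suffices to show X = F2BoxRowCapRS_ge_m81o2 ∧ CapRS: (i) a CERTIFIED thermodynamic-limit
`D₄`-orbit LOWER row `q ≤ ·` with `q ≥ −81/2`
on the NEGATED 3 × 3 box d-wave pair word `−Σ_{x,y∈B} Φ_x†Φ_y` (B = {−1,0,1}², |B|² = 81) over the
torus-limit ground-state class at
(U, n, t′) = (8, 7/8, 0), valid for every state with energy density ≤ u_RS = −12525490015723/2⁴⁴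
(the cell's cap of record #524), and
(ii) the cap leaf `MbsolverRungLeaves.M3Upper_tp0_le_RS` (∃ hi ≤ u_RS, e ≤ hi) give, by
hubbard-obs-p1's
`Observables.M3ObsPairLROCeilingAt_tp0_of_orbitRow` (p405359) with c = 1/2 ≥ −q/81, the
SUMMIT-FORMAT leaf `M3ObsPairLROCeiling_tp0`:
liminf_k |Λ_{2k}|⁻² Σ_{x,y} P_d(2k; x, y) ≤ 1/2 for every family of unit (rectN (7/8) L, S^z =
0)-sector ground states of `hubbardTorusTT' L 1 0 8`
(the venture's own pair-field LRO sequence). The same two items also give the Bragg-weight leaf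
`M3ObsODLROCeiling_tp0` (`_of_orbitRow`, p402180;
checked in this seat's SketchD.lean `odlro_also`). D-0145 LINES registration, R-OBS
(director-hubbard g11: "the lines seat registers the OBS
routes so future mints cite item ids"); producers = hubbard-obs / EXT5-L⁺ / T2 lanes (F₂ edge) and
this cell's cap lane. HONEST FRAMING:
first certified bounds; a CEILING says nothing about the presence of pairing;
«normalisation-limited» (at R = 2 the Fejér ceiling is ≥ 0.22
even for the exact state, never informative versus the printed m_d² ≲ 1.3·10⁻³); today's certified
edge is −q₀/81 = 0.9388 (K = 40, cap #354,
floor #473: `Certificates.obs0b_F2_EXT5Lp_M3U8tp0_c354f473_up_odlroLeaves_threshold_not_met`), ×1.88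
short; not a superconductivity verdict.
Lean: `(∃ q : ℚ, (-81/2 : ℚ) ≤ q ∧ Summit.Ventures.CertifiedManyBodySolver.M3CorrOrbitLowerRow 0
(-12525490015723/17592186044416) q Finset.univ ((Fintype.piFinset fun _ : Fin 2 => Finset.Icc (-1 :
ℤ) 1).biUnion (Literature.MathematicalPhysics.QuantumLattice.pairRegion (insert (0 :
Literature.Probability.LatticeModels.Site 2)
Literature.MathematicalPhysics.QuantumLattice.unitSteps)))
(-Summit.Ventures.CertifiedManyBodySolver.Observables.pairBoxWord (insert (0 :
Literature.Probability.LatticeModels.Site 2)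
Literature.MathematicalPhysics.QuantumLattice.unitSteps)
Literature.MathematicalPhysics.QuantumLattice.dWaveFormFactor (Fintype.piFinset fun _ : Fin 2 =>
Finset.Icc (-1 : ℤ) 1))) ∧
Summit.Ventures.CertifiedManyBodySolver.MbsolverRungLeaves.M3Upper_tp0_le_RS`

## Assembly
Pure logic on the two items through `Observables.M3ObsPairLROCeilingAt_tp0_of_orbitRow` (box
nonempty / |B|² = 81 from
`Certificates.obs0bl_F2_T2x5w5d2c3b4_tp0_box_nonempty/_box_card`), `hhi : hi ≤ u_RS`, and `−q/81 ≤
1/2` by `linarith` from `−81/2 ≤ q`.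

CLOSES_TARGET: closes rung M3obsODLRO of Ventures/CertifiedManyBodySolver: Summit.Ventures.CertifiedManyBodySolver.Observables.M3ObsPairLROCeiling_tp0 (D-0061; not the summit Statement) — the deciding theorem of this route concludes that registered leaf (Ventures/CertifiedManyBodySolver: no summit Statement) (class rung: servable and labelled, never counted as concluding the summit Statement).

Rationale: WHY THIS LINE. The OBS leaves of the venture (Observables/RungLeaves.lean, RungLeavesSummit.lean;
obs-lit 2026-08-25) are threshold sentences with NO energy
hypothesis inside; every proof offered so far is conditional on claim nodes, and the reduction
theorems (`…_of_orbitRow`, p402180/p405359) take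
exactly two certified inputs: an orbit row on the negated box pair word at an energy cap u, and a
cap row `e ≤ hi ≤ u`. The route DECLARES that
split at the cap of record u_RS (#524, all-k plaquette-RS dressed-box tiling), so the two producers
get one item each: the obs SDP lane must
deliver −q ≤ 81/2 at cap u_RS (any certificate computed at a looser cap u ≥ u_RS transports by
`M3CorrOrbitLowerRow.mono`; WangEtAl2024 §III),
the cap lane must kernel-replay #524 (`Certificates.rungLeaf_M3Upper_tp0_le_RS_of_r524`). Physically
the statement has a wide margin — the true
F₂/81 is ≈ the normalisation floor 0.22 plus m_d²-size terms (Scalapino1995 §2 eq. (2.4);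
QinEtAl2020: no d-wave LRO at t′ = 0, 1/8 doping) — so
the crux is a RELAXATION-STRENGTH question: the EXT5-L⁺ K = 40 dual stalled at 0.9388 with a primal
floor 0.3266 [float], the pre-registered band
is [0.30, 0.45] (lead d35), and a tighter cap lowers the dual. We chose the summit-format leaf (the
venture's own LRO sequence) over the
Bragg-weight twin because it is the one the summit funnel reads; the twin follows from the same
items. No superconductivity prediction is made by
this line.

RANKED CRUXES. #2 F2BoxRowCapRS_ge_m81o2 (crux) — a certified D₄-orbit lower row q ≤ ⟨−W_B⟩ with q ≥
−81/2 on the negated 3 × 3 box d-wave pair word over the torus-limit ground-state class at (8, 7/8,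
0), at energy cap u_RS = −12525490015723/2⁴⁴ (translation-reduced Fejér form F₂, PAIRCORR-SDP (O2);
producers hubbard-obs EXT5-L⁺ / T2 lanes; today −q₀/81 = 0.9388 at K = 40, cap #354, floor #473).
[difficulty: L] (why it might fail: the converged optimum of the footprint-(≤3,5) EXT5-L⁺ relaxation
may itself exceed 81/2·(−1) — primal floor 0.3266·81 = 26.5 [float] leaves room but the K = 40 dual
stalled at 76.0; degree-4 moments barely constrain |r|∞ = 2 pair words (Hastings2022), so K ≈ 60–80
/ T2-class words may be needed.) [Scalapino1995, Han2020Bootstrap, Hastings2022, WangEtAl2024,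
QinEtAl2020]
#3 CapRS (crux) — the cap leaf of record BY NAME, `MbsolverRungLeaves.M3Upper_tp0_le_RS`: ∃ hi ≤
−12525490015723/2⁴⁴ = −0.7119916754 with e(1,0,8,7/8) ≤ hi — the kernel replay of the all-k
plaquette-RS dressed-box-tiling certificate #524 (`Certificates.cert_dbt299plaqRS_allk` →
`rungLeaf_M3Upper_tp0_le_RS_of_r524`), or any tighter certified cap. [difficulty: M] (why it might
fail: the all-k node is a FORMAT-dbt2 §3 identity over a bond-dimension-299 MPS on the 32 × 4 box
(exact rational box energy #299 + seam increment Δ); its kernel replay in exact arithmetic may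
exceed interval/size budgets — the bound is variational, so the risk is replay, not truth.)
[Ruelle1969, ZhengEtAl2017, QinEtAl2020]

TWO-LAYER PLAN. Foreseen (BC3 birth skeletons, nothing filed now): F2BoxRowCapRS_ge_m81o2 ⇐
F2DualNode (the obs certificate in its DIRECT two-row node form
`M3EnergyLowerRow 0 q₄₇₃ → orbit row at cap u₃₅₄ with q ≥ −81/2`) → Floor473 (replay of #473, or
from #529 by monotonicity) → cap transport
u_RS ≤ u₃₅₄ (`M3CorrOrbitLowerRow.mono`, provable now); CapRS ⇐ RSAllkNode (`cert_dbt299plaqRS_allk`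
replay) → `rungLeaf_M3Upper_tp0_le_RS_of_r524`
(in tree). Rungs (plan-only): today's F₂ node `cert_obs0b_F2_EXT5Lp_M3U8tp0_c354f473_up` (q₀ =
−76.04) and the finite-k cap node `cert_dbt299plaqRS_k64`.

KILL CRITERIA. A certified LOWER bound on the box pair word giving F₂/81 > 1/2 for some state of the
class with e ≤ u_RS (e.g. a variational torus family with
certified m_d² > 1/2 — physically absurd at 1/8 doping, QinEtAl2020) refutes the F₂ crux; a
certified LOWER energy row above u_RS refutes CapRS (and

NOT DECOMPOSED YET. Which relaxation reaches −q ≤ 40.5 (K, word set, cap); whether the cap should be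
declared at a future tighter cap (that is a restate, tenure);
the Bragg-weight twin leaf `M3ObsODLROCeiling_tp0` (same items; `odlro_also` in SketchD.lean) is not
given its own route.

CHEAPEST FALSIFIER. Lookups run by this seat: (i) today's node is short: `(1/2 : ℚ) < F₂^up/81`
(`…_threshold_not_met`, in tree) and `q₀ < −81/2` (SketchD
`todays_F2_short`, norm_num); (ii) cap order u_RS ≤ u₃₅₄ (SketchD `capRS_le_cap354`), so every
existing obs certificate transports to the declared
cap; (iii) the leaf is NOT vacuous (a `∀ ψ … liminf ≤ 1/2` sentence; BC7 probe). The cheapest real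
kill is a converged primal value of the
EXT5-L⁺ relaxation above 40.5 at cap u_RS (one FO run of the obs lane, 0 kit from this seat).

NUMBERS. Threshold c = 1/2 ⇔ q ≥ −81/2 = −40.5. Today: q₀ =
−101073283961552226681550531670052223793/2¹²⁰ = −76.04, −q₀/81 = 0.9387542 (K = 40, cap
u₃₅₄ = −99352233445291/2⁴⁷ = −0.70594, floor #473 = −1012151804787154021296135/2⁸⁰ = −0.83723);
needed factor ×1.88. Primal floor of that
relaxation 0.3266·81 = 26.5 [float]; pre-registered band [0.30, 0.45]·81 = [24.3, 36.5];
normalisation floor ≈ 0.22·81 = 17.8. Declared cap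
u_RS = −12525490015723/2⁴⁴ = −0.7119916754 (#524 all-k); k = 64 node −6409490345606183/2⁵³ =
−0.7115902 (weaker, rung only).

DEFINITION REQUESTS. None.

Novelty: Searches (2026-08-27): corpus hybrid "rigorous upper bound d-wave pairing correlation Hubbard model
semidefinite relaxation certified" (books
only: Essler 2005, Gubernatis 2016, Xiang–Wu 2022 — no certified ceilings); galaxy pdf "pairing
correlations|off-diagonal long-range
order|Hubbard bootstrap" (noise); the venture tree (Observables/RungLeaves*.lean,
Certificates/*obs0b*): the only certified pairing ceilings at
(8, 7/8, 0) are the programme's own F₂ edges.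
Nearest prior art found: Scalapino1995 §2 eq. (2.4) (the observable), Han2020Bootstrap /
arXiv:2507.02386 (bootstrap energies and float
correlator bounds), hubbard-obs-p1 p402180/p405359 (the reduction theorems), certificate j242461
(0.9388).
Delta: the first typed decision of the summit-format pair-LRO ceiling leaf as a declared two-item
split (obs row at the cap of record ∧ cap
leaf); a registration (crew rung route), not a mechanism.
Claimed grade: known  [refs: 2507.02386, Scalapino1995]

Barriers (technique_class: sdp-correlator-ceiling, certified-upper-bound, energy-window): - technique_class: sdp-correlator-ceiling, certified-upper-bound, energy-window
- Literature.Barriers.HubbardSuperconductivity.EnergyWindowCeilingResolution: inside its class — a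
ceiling read through an energy window of width w cannot resolve below the window-induced slack; the
bet is that the coarse threshold 1/2 (far above the 0.22 normalisation floor) is within reach at w =
0.1176, and the cap item is exactly the lever that narrows w.
- Literature.Barriers.HubbardSuperconductivity.OrderParameterInvisibleToGroundStateConstraints: not
applicable — it obstructs certifying the PRESENCE of order from ground-state constraints; this line
certifies a CEILING (absence-side), which moment relaxations do see.
- Literature.Barriers.HubbardSuperconductivity.DegreeFourSosMissesSecondOrderPerturbation: inside
its class for the F₂ crux (degree-4 words under-constrain range-2 pair correlators); the bet is K ≈
60–80 / T2-class words at a tighter cap, not exactness.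
- Literature.Barriers.HubbardSuperconductivity.SignProblemNPHard: outside its class — nothing is
sampled (exact dual functional, explicit MPS).
- Literature.Barriers.HubbardSuperconductivity.PositiveTemperatureNoPairLRO: not applicable (ground
states, and a ceiling is consistent with it anyway).
- Negatives index: `ledger negatives --problem Ventures` — no refuted statement concerns a pair-word
orbit row or the RS cap.

History (route lifecycle, newest last):
- 2026-08-31T08:46:17Z · DORMANT — director-hubbard g25 08:45:16Z (3): F2-PRIMAL letter (C) by record 08-31: EXT5-L⁺ degree-4 optimum −76.04 at u₃₅₄ (j242461 converged pair), first-order transpor (operator:999:911953)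

sub-problem: CertifiedManyBodySolver · status: dormant · opened planner-hubbard-m3-lines-1-g0-0 2026-08-27T21:10:45Z · rev 3 · ledger route-Ventures-M3ObsPairLroHalfViaF2
GENERATED by the gate from the ledger (D-0016/17). Provers cite these decls: `theorem foo : Summit.Ventures.CertifiedManyBodySolver.Theses.M3ObsPairLroHalfViaF2.<Decl> := …` in Summits/Ventures/CertifiedManyBodySolver/Theorems/<Name>.lean.
-/

namespace Summit.Ventures.CertifiedManyBodySolver.Theses.M3ObsPairLroHalfViaF2

open scoped BigOperators Topology Manifold Classical MeasureTheory ProbabilityTheory Matrix InnerProductSpace ComplexConjugate ContinuousMap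
open Filter Set Function TopologicalSpace MeasureTheory

-- H21.Audit: Ventures rung route — no summit Statement decl; the expected conclusion is the closer leaf tagged below
attribute [summit_statement] _root_.Summit.Ventures.CertifiedManyBodySolver.Observables.M3ObsPairLROCeiling_tp0

/-- item stmt-Ventures-22686 · crux · rank 2 · open · by planner
why it might fail: the converged optimum of the footprint-(≤3,5) EXT5-L⁺ relaxation may itself exceed 81/2·(−1) — primal floor 0.3266·81 = 26.5 [float] leaves room but the K = 40 dual stalled at 76.0; degree-4 moments barely constrain |r|∞ = 2 pair words (Hastings2022), so K ≈ 60–80 / T2-class words may be needed.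
sources: Scalapino1995, Han2020Bootstrap, Hastings2022, WangEtAl2024, QinEtAl2020
[crux] a certified D₄-orbit lower row q ≤ ⟨−W_B⟩ with q ≥ −81/2 on the negated 3 × 3 box d-wave pair
word over the torus-limit ground-state class at (8, 7/8, 0), at energy cap u_RS =
−12525490015723/2⁴⁴ (translation-reduced Fejér form F₂, PAIRCORR-SDP (O2); producers hubbard-obs
EXT5-L⁺ / T2 lanes; today −q₀/81 = 0.9388 at K = 40, cap #354, floor #473). [difficulty: L] -/
@[route_item "route-Ventures-M3ObsPairLroHalfViaF2"]
def F2BoxRowCapRS_ge_m81o2 : Prop :=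
  ∃ q : ℚ, (-81/2 : ℚ) ≤ q ∧ Summit.Ventures.CertifiedManyBodySolver.M3CorrOrbitLowerRow 0 (-12525490015723/17592186044416) q Finset.univ ((Fintype.piFinset fun _ : Fin 2 => Finset.Icc (-1 : ℤ) 1).biUnion (Literature.MathematicalPhysics.QuantumLattice.pairRegion (insert (0 : Literature.Probability.LatticeModels.Site 2) Literature.MathematicalPhysics.QuantumLattice.unitSteps))) (-Summit.Ventures.CertifiedManyBodySolver.Observables.pairBoxWord (insert (0 : Literature.Probability.LatticeModels.Site 2) Literature.MathematicalPhysics.QuantumLattice.unitSteps) Literature.MathematicalPhysics.QuantumLattice.dWaveFormFactor (Fintype.piFinset fun _ : Fin 2 => Finset.Icc (-1 : ℤ) 1))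

/-- item stmt-Ventures-22687 · crux · rank 3 · open · by planner
why it might fail: the all-k node is a FORMAT-dbt2 §3 identity over a bond-dimension-299 MPS on the 32 × 4 box (exact rational box energy #299 + seam increment Δ); its kernel replay in exact arithmetic may exceed interval/size budgets — the bound is variational, so the risk is replay, not truth.
sources: Ruelle1969, ZhengEtAl2017, QinEtAl2020
[crux] the cap leaf of record BY NAME, `MbsolverRungLeaves.M3Upper_tp0_le_RS`: ∃ hi ≤
−12525490015723/2⁴⁴ = −0.7119916754 with e(1,0,8,7/8) ≤ hi — the kernel replay of the all-k
plaquette-RS dressed-box-tiling certificate #524 (`Certificates.cert_dbt299plaqRS_allk` →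
`rungLeaf_M3Upper_tp0_le_RS_of_r524`), or any tighter certified cap. [difficulty: M] -/
@[route_item "route-Ventures-M3ObsPairLroHalfViaF2"]
def CapRS : Prop :=
  Summit.Ventures.CertifiedManyBodySolver.MbsolverRungLeaves.M3Upper_tp0_le_RS

/-- item stmt-Ventures-22688 · assembly · rank 1 · open · by planner
sources: Scalapino1995, WangEtAl2024
[assembly] F2BoxRowCapRS_ge_m81o2 → CapRS → M3ObsPairLROCeiling_tp0. -/
@[route_item "route-Ventures-M3ObsPairLroHalfViaF2"]
def Assembly : Prop :=
  F2BoxRowCapRS_ge_m81o2 → CapRS → Summit.Ventures.CertifiedManyBodySolver.Observables.M3ObsPairLROCeiling_tp0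

/-! D-0027 §2.1 — DECIDING THEOREM (planner-authored via `route open/edit --closes-file`; by planner-hubbard-m3-lines-1-g0-0 2026-08-27T21:10:46Z):
its hypotheses are this route's items and its conclusion the registered leaf `Summit.Ventures.CertifiedManyBodySolver.Observables.M3ObsPairLROCeiling_tp0` (rung M3obsODLRO, D-0061) (glue_lint), and it elaborates with this file. -/

@[closes "route-Ventures-M3ObsPairLroHalfViaF2"] theorem closes (h₂ : F2BoxRowCapRS_ge_m81o2) (h₃ : CapRS) :
    Summit.Ventures.CertifiedManyBodySolver.Observables.M3ObsPairLROCeiling_tp0 := by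
  have hA : Assembly := by
    intro hF hC
    obtain ⟨q, hq, hrow⟩ := hF
    obtain ⟨hi, hhi, hE⟩ := hC
    have hq' : ((-81/2 : ℚ) : ℝ) ≤ ((q : ℚ) : ℝ) := by exact_mod_cast hq
    have h81 : ((((Fintype.piFinset fun _ : Fin 2 => Finset.Icc (-1 : ℤ) 1) : Finset (Literature.Probability.LatticeModels.Site 2)).card : ℝ)) ^ 2 = 81 := by
      rw [Summit.Ventures.CertifiedManyBodySolver.Certificates.obs0bl_F2_T2x5w5d2c3b4_tp0_box_card]; norm_num
    show Summit.Ventures.CertifiedManyBodySolver.Observables.M3ObsPairLROCeilingAt_tp0 (1 / 2)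
    refine Summit.Ventures.CertifiedManyBodySolver.Observables.M3ObsPairLROCeilingAt_tp0_of_orbitRow
      Summit.Ventures.CertifiedManyBodySolver.Certificates.obs0bl_F2_T2x5w5d2c3b4_tp0_box_nonempty hrow hE hhi ?_
    rw [h81]; push_cast at hq' ⊢; linarith
  exact hA h₂ h₃

end Summit.Ventures.CertifiedManyBodySolver.Theses.M3ObsPairLroHalfViaF2
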